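import Mathlib
import HarnessLib

/-!
# Two elementary lemmas of the Dolgopyat–Naud cancellation argument (Magee–Oh–Winter §4.6)

Support file (all results proved) for the programme of proving [MageeOhWinter2019, Thm. 4 (2)]
(Dolgopyat bounds for the congruence transfer operators, after Naud), the last input of the named fact
`Literature.NumberTheory.Sieve.MageeOhWinter2019_uniformCounting` that is a provable theorem rather than an
expansion input. This file contains the two dimension-free elementary lemmas of §4.6:

* `norm_add_le_of_re_inner_le` — **the sharp triangle inequality** ([MageeOhWinter2019, Lemma 31]; Naud,
  Lemma 5.12): in a complex inner product space, if `‖z₁‖ ≤ L ‖z₂‖` and `Re⟨z₁, z₂⟩ ≤ (1-η)‖z₁‖‖z₂‖` then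
  `‖z₁ + z₂‖ ≤ (1-δ)‖z₁‖ + ‖z₂‖` with `δ = η/(L+1)` depending only on `L, η` ("the fact that there is no
  dependence on the dimension of `V` is one of the crucial points");
* `naud_alternative` — **Naud's alternative on short intervals** ([MageeOhWinter2019, Lemma 30] = Naud,
  Lemma 5.11): on an interval `Z` of length `≤ c/|b|`, for `H > 0` in the cone `|H'| ≤ A|b|H` and a `C¹`
  vector-valued `f` with `‖f‖ ≤ H`, `‖f'‖ ≤ A|b|H`: if `A c ≤ 1/10` then either `‖f‖ ≤ ¾ H` on `Z` or
  `‖f‖ ≥ ¼ H` on `Z` (with the comparison `H(v) ≤ e^{A|b||v-u|} H(u)`, `exp_cone_compare`).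

## References

* [MageeOhWinter2019] M. Magee, H. Oh, D. Winter, J. reine angew. Math. 753 (2019) 89–135, §4.6,
  Lemmas 30 and 31 (after F. Naud, Ann. Sci. ÉNS 38 (2005), Lemmas 5.11, 5.12).
-/

noncomputable section

open Set

namespace Literature.NumberTheory.Sieve

/-! ### The sharp triangle inequality -/

section SharpTriangle

variable {V : Type*} [NormedAddCommGroup V] [InnerProductSpace ℂ V]

/-- **Sharp triangle inequality** (dimension-free): if `‖z₁‖ ≤ L‖z₂‖` and
`Re⟨z₁, z₂⟩ ≤ (1 - η)‖z₁‖‖z₂‖` with `0 ≤ η ≤ 1`, `0 ≤ L`, then `‖z₁ + z₂‖ ≤ (1 - η/(L+1))‖z₁‖ + ‖z₂‖`.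
[cite: MageeOhWinter2019, Lemma 31] -/
theorem norm_add_le_of_re_inner_le {L η : ℝ} (hL : 0 ≤ L) (hη0 : 0 ≤ η) (hη1 : η ≤ 1) (z₁ z₂ : V)
    (hsize : ‖z₁‖ ≤ L * ‖z₂‖) (hangle : (inner ℂ z₁ z₂).re ≤ (1 - η) * (‖z₁‖ * ‖z₂‖)) :
    ‖z₁ + z₂‖ ≤ (1 - η / (L + 1)) * ‖z₁‖ + ‖z₂‖ := by
  set δ : ℝ := η / (L + 1) with hδ
  have hδ0 : 0 ≤ δ := by positivity
  have hδ1 : δ ≤ 1 := by rw [hδ, div_le_one (by linarith)]; linarith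
  have hx0 : 0 ≤ ‖z₁‖ := norm_nonneg _
  have hy0 : 0 ≤ ‖z₂‖ := norm_nonneg _
  have hre : RCLike.re (inner ℂ z₁ z₂) ≤ (1 - η) * (‖z₁‖ * ‖z₂‖) := hangle
  -- `‖z₁ + z₂‖² ≤ (x + y)² - 2ηxy ≤ ((1-δ)x + y)²`
  have hδxy : δ * (‖z₁‖ + ‖z₂‖) ≤ η * ‖z₂‖ := by
    rw [hδ, div_mul_eq_mul_div, div_le_iff₀ (by linarith)]
    nlinarith [mul_nonneg hη0 hy0]
  have hsq : ‖z₁ + z₂‖ ^ 2 ≤ ((1 - δ) * ‖z₁‖ + ‖z₂‖) ^ 2 := by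
    rw [@norm_add_sq ℂ]
    nlinarith [mul_nonneg hδ0 hx0, mul_nonneg (mul_nonneg hδ0 hx0) (sub_nonneg.2 hδ1), mul_nonneg hx0 hy0,
      mul_nonneg (mul_nonneg hδ0 hx0) hx0]
  have hR : 0 ≤ (1 - δ) * ‖z₁‖ + ‖z₂‖ := by nlinarith
  calc ‖z₁ + z₂‖ = Real.sqrt (‖z₁ + z₂‖ ^ 2) := by rw [Real.sqrt_sq (norm_nonneg _)]
    _ ≤ Real.sqrt (((1 - δ) * ‖z₁‖ + ‖z₂‖) ^ 2) := Real.sqrt_le_sqrt hsq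
    _ = (1 - δ) * ‖z₁‖ + ‖z₂‖ := Real.sqrt_sq hR

/-- The sharp triangle inequality in the paper's form: for `L ≥ 0`, `0 < η ≤ 1` there is `δ ∈ (0,1)`
depending only on `L, η` with `‖z₁ + z₂‖ ≤ (1 - δ)‖z₁‖ + ‖z₂‖` whenever `‖z₁‖ ≤ L‖z₂‖` and
`Re⟨z₁, z₂⟩ ≤ (1-η)‖z₁‖‖z₂‖` (in ANY complex inner product space). [cite: MageeOhWinter2019, Lemma 31] -/
theorem exists_sharp_triangle {L η : ℝ} (hL : 0 ≤ L) (hη0 : 0 < η) (hη1 : η ≤ 1) :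
    ∃ δ : ℝ, 0 < δ ∧ δ < 1 ∧ ∀ (W : Type*) [NormedAddCommGroup W] [InnerProductSpace ℂ W] (z₁ z₂ : W),
      ‖z₁‖ ≤ L * ‖z₂‖ → (inner ℂ z₁ z₂).re ≤ (1 - η) * (‖z₁‖ * ‖z₂‖) → ‖z₁ + z₂‖ ≤ (1 - δ) * ‖z₁‖ + ‖z₂‖ := by
  refine ⟨η / (L + 2), by positivity, ?_, fun W _ _ z₁ z₂ h1 h2 => ?_⟩
  · rw [div_lt_one (by linarith)]; linarith
  · refine (norm_add_le_of_re_inner_le hL hη0.le hη1 z₁ z₂ h1 h2).trans ?_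
    have hmono : η / (L + 2) ≤ η / (L + 1) := div_le_div_of_nonneg_left hη0.le (by linarith) (by linarith)
    nlinarith [norm_nonneg z₁]

end SharpTriangle

/-! ### Naud's alternative on short intervals -/

section Alternative

variable {E : Type*} [NormedAddCommGroup E] [NormedSpace ℝ E]

/-- **Comparison inside the cone:** if `H > 0` on a convex `Z` with `|H'| ≤ K H` there, then
`H(v) ≤ e^{K|v-u|} H(u)` for `u, v ∈ Z` (mean value theorem for `log H`). [cite: MageeOhWinter2019, §4.3 (cone `C_A`)] -/
theorem exp_cone_compare {K : ℝ} {Z : Set ℝ} (hZ : Convex ℝ Z) {H H' : ℝ → ℝ}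
    (hHpos : ∀ u ∈ Z, 0 < H u) (hHd : ∀ u ∈ Z, HasDerivWithinAt H (H' u) Z u) (hHc : ∀ u ∈ Z, |H' u| ≤ K * H u)
    {u v : ℝ} (hu : u ∈ Z) (hv : v ∈ Z) : H v ≤ Real.exp (K * |v - u|) * H u := by
  -- `log H` has derivative `H'/H`, bounded by `K`
  have hlogd : ∀ w ∈ Z, HasDerivWithinAt (fun t => Real.log (H t)) (H' w / H w) Z w :=
    fun w hw => (hHd w hw).log (hHpos w hw).ne'
  have hbound : ∀ w ∈ Z, ‖H' w / H w‖ ≤ K := fun w hw => by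
    rw [Real.norm_eq_abs, abs_div, abs_of_pos (hHpos w hw), div_le_iff₀ (hHpos w hw)]
    exact hHc w hw
  have hmvt := hZ.norm_image_sub_le_of_norm_hasDerivWithin_le hlogd hbound hu hv
  rw [Real.norm_eq_abs, Real.norm_eq_abs] at hmvt
  have h1 : Real.log (H v) ≤ Real.log (H u) + K * |v - u| := by
    have := (le_abs_self _).trans hmvt; linarith
  calc H v = Real.exp (Real.log (H v)) := (Real.exp_log (hHpos v hv)).symm
    _ ≤ Real.exp (Real.log (H u) + K * |v - u|) := Real.exp_le_exp.2 h1
    _ = Real.exp (K * |v - u|) * H u := by rw [Real.exp_add, Real.exp_log (hHpos u hu), mul_comm]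

/-- **Naud's alternative on short intervals.** Let `Z` be convex with `|u - v| ≤ c/|b|` for `u, v ∈ Z`,
`H > 0` with `|H'| ≤ A|b|H` on `Z`, and `f : ℝ → E` with `‖f'‖ ≤ A|b|H` on `Z` (derivatives within `Z`; the
paper's further hypothesis `‖f‖ ≤ H` is not needed). If `A c ≤ 1/10` then either `‖f(u)‖ ≤ ¾ H(u)` for all `u ∈ Z`, or `‖f(u)‖ ≥ ¼ H(u)` for all `u ∈ Z`.
[cite: MageeOhWinter2019, Lemma 30] -/
theorem naud_alternative {A b c : ℝ} (hA : 0 ≤ A) (hc : 0 ≤ c) (hcA : A * c ≤ 1 / 10) (hb : b ≠ 0)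
    {Z : Set ℝ} (hZ : Convex ℝ Z) (hdiam : ∀ u ∈ Z, ∀ v ∈ Z, |u - v| ≤ c / |b|)
    {H H' : ℝ → ℝ} (hHpos : ∀ u ∈ Z, 0 < H u) (hHd : ∀ u ∈ Z, HasDerivWithinAt H (H' u) Z u)
    (hHc : ∀ u ∈ Z, |H' u| ≤ A * |b| * H u)
    {f f' : ℝ → E} (hfd : ∀ u ∈ Z, HasDerivWithinAt f (f' u) Z u)
    (hf'H : ∀ u ∈ Z, ‖f' u‖ ≤ A * |b| * H u) :
    (∀ u ∈ Z, ‖f u‖ ≤ 3 / 4 * H u) ∨ (∀ u ∈ Z, 1 / 4 * H u ≤ ‖f u‖) := by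
  by_cases hcase : ∀ u ∈ Z, ‖f u‖ ≤ 3 / 4 * H u
  · exact Or.inl hcase
  · right
    push Not at hcase
    obtain ⟨u₀, hu₀, hbig⟩ := hcase
    intro u hu
    have hb0 : 0 < |b| := abs_pos.2 hb
    have hK : 0 ≤ A * |b| := mul_nonneg hA hb0.le
    -- cone comparisons with the base point `u`
    have hcomp : ∀ v ∈ Z, H v ≤ Real.exp (A * c) * H u := fun v hv => by
      refine (exp_cone_compare hZ hHpos hHd hHc hu hv).trans (mul_le_mul_of_nonneg_right ?_ (hHpos u hu).le)
      refine Real.exp_le_exp.2 ?_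
      calc A * |b| * |v - u| ≤ A * |b| * (c / |b|) := mul_le_mul_of_nonneg_left (hdiam v hv u hu) hK
        _ = A * c := by field_simp
    have hcomp' : H u ≤ Real.exp (A * c) * H u₀ := by
      refine (exp_cone_compare hZ hHpos hHd hHc hu₀ hu).trans (mul_le_mul_of_nonneg_right ?_ (hHpos u₀ hu₀).le)
      refine Real.exp_le_exp.2 ?_
      calc A * |b| * |u - u₀| ≤ A * |b| * (c / |b|) := mul_le_mul_of_nonneg_left (hdiam u hu u₀ hu₀) hK
        _ = A * c := by field_simp
    -- `‖f u - f u₀‖ ≤ (A|b| e^{Ac} H u) · (c/|b|) = A c e^{Ac} H u`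
    have hderiv_bd : ∀ v ∈ Z, ‖f' v‖ ≤ A * |b| * (Real.exp (A * c) * H u) := fun v hv =>
      (hf'H v hv).trans (mul_le_mul_of_nonneg_left (hcomp v hv) hK)
    have hmvt := hZ.norm_image_sub_le_of_norm_hasDerivWithin_le hfd hderiv_bd hu₀ hu
    rw [Real.norm_eq_abs] at hmvt
    have hdiff : ‖f u - f u₀‖ ≤ A * c * Real.exp (A * c) * H u := by
      refine hmvt.trans ?_
      calc A * |b| * (Real.exp (A * c) * H u) * |u - u₀| ≤ A * |b| * (Real.exp (A * c) * H u) * (c / |b|) :=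
            mul_le_mul_of_nonneg_left (hdiam u hu u₀ hu₀) (by have := (hHpos u hu).le; positivity)
        _ = A * c * Real.exp (A * c) * H u := by field_simp
    -- numerics: `e^{Ac} ≤ 1/(1 - Ac) ≤ 10/9`, `H u₀ ≥ (1 - Ac) H u`, so `¾(1-Ac) - (10/9)Ac ≥ ¼`
    have hx0 : 0 ≤ A * c := mul_nonneg hA hc
    have he : Real.exp (A * c) ≤ 1 / (1 - A * c) := Real.exp_bound_div_one_sub_of_interval hx0 (by linarith)
    have he' : Real.exp (A * c) ≤ 10 / 9 := by
      refine he.trans ?_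
      rw [div_le_div_iff₀ (by linarith) (by norm_num)]; linarith
    have hHu : 0 < H u := hHpos u hu
    have hHu₀ : (1 - A * c) * H u ≤ H u₀ := by
      have h1 : H u ≤ (1 / (1 - A * c)) * H u₀ := hcomp'.trans (mul_le_mul_of_nonneg_right he (hHpos u₀ hu₀).le)
      have h2 : 0 < 1 - A * c := by linarith
      calc (1 - A * c) * H u ≤ (1 - A * c) * ((1 / (1 - A * c)) * H u₀) := mul_le_mul_of_nonneg_left h1 h2.le
        _ = H u₀ := by field_simp
    have htri : ‖f u₀‖ - ‖f u‖ ≤ ‖f u - f u₀‖ := by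
      rw [norm_sub_rev]; exact norm_sub_norm_le _ _
    have hprod : A * c * Real.exp (A * c) * H u ≤ A * c * (10 / 9) * H u :=
      mul_le_mul_of_nonneg_right (mul_le_mul_of_nonneg_left he' hx0) hHu.le
    nlinarith [hdiff, htri, hbig, hHu₀, hprod, hHu, hcA]

end Alternative

end Literature.NumberTheory.Sieve
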